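import Literature.MathematicalPhysics.QuantumFieldTheory.Balaban1983to89.B9Ineq363L2
import Literature.MathematicalPhysics.QuantumFieldTheory.Balaban1983to89.B6RandomWalkL2ChainLeft

/-!
# `Balaban1983to89.B9Ineq363L2Right` — [B9] (3.63)∕(3.65) IN THE `L²` NORMS OF THEOREM 3.1 (3.46), THE RIGHT SIDE: the left composite
# `G′(U)·V′(A)` of the concrete `V′(A)` (3.60) through BLOCK-ℓ² majorants (commutator letters of the lattice Leibniz rule in ℓ²), the first
# form of (3.65) from the inverse identities, and ★★ the RIGHT (3.46)-entries `G′(U′U)∇*` by the left-routed ℓ²-summed walk (3.64) — sequel of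
# `B9Ineq363L2` (left entries) on the ℓ²-block route of Sect. B

T. Bałaban, *Propagators for lattice gauge theories in a background field*, Commun. Math. Phys. **99** (1985) 389–434
[`Balaban1985BackgroundPropagators`, "B9"]; [4] = T. Bałaban, *Propagators and renormalization transformations for lattice gauge theories. II*,
Commun. Math. Phys. **96** (1984) 223–250 [`Balaban1984PropagatorsII`].

statement-level skeleton of published theorems with citation tags; proofs where landed; nothing here is a claim about the Yang–Mills mass gap

THE PRINTED LOCUS (verbatim).  p. 402: *"the operator V′(A)G′(U) satisfies the bound |(V′(A)G′(U)λ)(x)| ≦ O(1)B₀α₁e^{−δ₀d(y,y′)}|λ| (3.63) …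
G′(U′U) = G′(U) Σ_{n=0}^∞ (V′(A)G′(U))ⁿ (3.64)"*; p. 403 l. 1–9: *"applying Theorem 3.1 for G′(U), the bound (3.63), the representation (3.64) and
Lemma 2.1 of [4] we can prove all the statements (3.42)–(3.47) of Theorem 3.1 for the operator G′(U′U), of course with different constants"*;
Theorem 3.1 (3.46) p. 398: *"‖hG′(U)λ‖, ‖h∇_UG′(U)λ‖, ‖hG′(U)∇*_Uλ‖, … ≤ B₀[(Lʲη)², Lʲη, Lʲη, …]|h|e^{−δ₀d(y,y′)}‖λ‖"*; p. 398 (remarks): *"we may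
always replace ∇_U by ∇*_U … Using Lemma 2.1 in [4] we may replace the factor (Lʲη)^α by (Lʲη)^β(L^{j′}η)^γ"*; [4] p. 247: *"the series above is
convergent in the norms appearing in the inequalities (2.136)–(2.140)"*.

WHY THIS FILE (pub-ymgap N06 row 13, the ℓ²-block route for the DISPLAYED `L²` member-steps of `B9SectBStepFrameV2.SectBFrame₂`).  `B9Ineq363L2` gave the
LEFT entries `X·G′(U′U)` (members n = 0, 1 of (3.46)) from the second form of (3.65).  The RIGHT entries (member n = 2, `G′(U′U)∇*`, and the factor
of member n = 4) need (i) the left composite `G′(U)·V′(A)` in ℓ² — by the lattice Leibniz rule `V¹_k∇_k = ∇_kV¹_k + [V¹_k, ∇_k]` the words are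
`(G′(U)∇_k)·V¹_k` (Theorem 3.1's RIGHT member at U times a pointwise letter) and `G′(U)·((V⁰ − avg) + Σ_k[V¹_k, ∇_k])` (the commutators are
one-point-stencil letters of size `α₁(Lʲη)⁻²`, (3.37)) —, (ii) the first form `G′(U′U) = G′(U) + G′(U)V′(A)G′(U′U)` of (3.65), and (iii) the
left-routed walk with the power of `Lʲη` moved by p. 398's convention (`B6RandomWalkL2ChainLeft`).

WHAT IS IN THE FILE (theorems only; 0 sorry; standard axioms).
§1 `hasL2Majorant_commLetterF` ∕ `hasL2Majorant_commLetterB` ∕ ★ `hasL2Majorant_comm_coefLetter_diffLetter` — the commutator letters of (3.52) in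
  block-ℓ² form (`B9Ineq361L2Letters.hasL2Majorant_conj_of_local`, multiplicity 1; r06's pointwise sizes `norm_commLetterF_le`∕`…B_le` BY NAME).
§2 `hasL2Majorant_GV_of_divForm_sum_l2`, `hasL2Majorant_C₃_of_comm_sum_l2`, ★ `hasL2Majorant_GV_of_gradForm_comm_sum_l2` — the ℓ² twins of r06's
  `B9Ineq386CommSum` right-composite device (`divForm_of_gradForm_sum` BY NAME; y″-sums by `B9Ineq363L2.hasL2Majorant_comp_decay`).
§3 ★ `hasL2Majorant_gp_vPrime` — `G′(U)·conj b V′(A) ≺₂ θ_R·e^{−ρd}` for the CONCRETE `V′(A)` of (3.60), `θ_R = B₀Λc₁(β)(cVL2 + 2|κ|·2ρu²M₂(Σ‖b‖)√#ι·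
  e^{δd₀})·α₁` EXPLICIT, from (3.46)₀ and (3.46)₂ at U in ℓ² + the non-propagator letter hypotheses of `B9Ineq363L2.ineq363_l2_vPrime` (+ the two
  coefficient-difference bounds `h337F`, `h337B` and the inverse-weight scale transfers).
§4 `eq365_first_of_inverse` (`G′(U)Δ′ = 1`, `(Δ′ − V′)G′(U′U) = 1` ⟹ `G′(U′U) = G′(U) + G′(U)(V′G′(U′U))`), ★★ `hasL2Majorant_rightEntry_gpExt` —
  **THE RIGHT (3.46)-ENTRIES OF `G′(U′U)`**: `G′(U)Y ≺₂ B·P(y)·e^{−δ₀d}`, `G′(U)V′ ≺₂ θe^{−δ₀d}`, (3.65)₁, p. 398 transfers of `P` at `(δ₀, α′)` and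
  `(δ₂, α″)`, (2.61) at `(δ₁, α)`, `θc₁ < 1` ⟹ `G′(U′U)Y ≺₂ BΛc₁(1 − θc₁)⁻¹Λ′·P(y)·e^{−(1−α″)δ₂d}` (`δ₁ = (1−α′)δ₀`, `δ₂ = (1−α)δ₁`;
  `B6RandomWalkL2ChainLeft.l2Majorant_rightEntry_of_leftFixedPoint` BY NAME).

WHAT IS NOT HERE (successor items): the frame-level step `StepL2nPos … Gp 2` (an `L²` reading of member 2 at U per concrete letter + a writing at
U′U on top of `B9SectBL2StepAtLettersV2.L2Frame₂`, with the smallness forced by `α₁`), member 4 (`∇G′(U′U)∇* = ∇G′(U)∇* + (∇G′(U)V′)·(G′(U′U)∇*)`: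
a product of §4 with a left composite at the letter `∇`), members 3, 5 (second differences), the G-twins.

HONEST SCOPE.  Finite-dimensional bookkeeping over r06's concrete letters; the propagator inputs ((3.46) at U, the inverse identities) are
hypotheses OF THE PRINTED SHAPE; nothing of [B9] asserted for Bałaban's propagators; count-neutral; NOT a node discharge; nothing continuum ∕ OS ∕
mass-gap ∕ Clay.  Cell `pub-ymgap` (HUMAN RULING D-0062), Track A node N06 [B9], N06-ASSIGNMENT row 13, seat `pub-ymgap-dag-n06-c` (g4), 2026-08-27.

RELATED IN THE TREE, NOT DUPLICATED: `B9Ineq363Vprime.hasMajorant_gp_vPrime` ∕ `gpExt_rightEntry_vPrime` (sup twins), `B9Eq352DivFormLetters`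
(`commLetterF∕B`, `mul_grad_comm_F∕B`, sup `hasMajorant_commLetterF∕B`), `B9Eq352GradLetters` (`conj_V1pOp_eq_gradForm`, sup `hasMajorant_comm_coefLetter_diffLetter`),
`B9Ineq386CommSum` (sup device), `B6RandomWalkHom.b9_rightEntry_of_365` (pv21's sup left walk), `B9Ineq361L2Letters` ∕ `B9Ineq363L2` ∕
`B6RandomWalkL2ChainLeft` (this seat) — no existing module modified.
-/

noncomputable section

open scoped BigOperators

namespace Literature.MathematicalPhysics.QuantumFieldTheory.Balaban1983to89.B9Ineq363L2Right

open Literature.MathematicalPhysics.QuantumFieldTheory.Balaban1983to89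
open Literature.MathematicalPhysics.QuantumFieldTheory.Balaban1983to89.B6RandomWalk (Triangle254 Ineq261)
open Literature.MathematicalPhysics.QuantumFieldTheory.Balaban1983to89.B6RandomWalkL2 (l2n HasL2Majorant hasL2Majorant_mono
  hasL2Majorant_add hasL2Majorant_mul)
open Literature.MathematicalPhysics.QuantumFieldTheory.Balaban1983to89.B9Thm34Ext (toB6)
open Literature.MathematicalPhysics.QuantumFieldTheory.Balaban1983to89.B9Ineq347 (ScaleTransfer)
open Literature.MathematicalPhysics.QuantumFieldTheory.Balaban1983to89.B9Eq39Adjoint (covD covDstar)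
open Literature.MathematicalPhysics.QuantumFieldTheory.Balaban1983to89.B9Eq352DivFormLetters (conj conj_sub conj_neg
  mulLetter gradLetterF gradLetterB commLetterF commLetterB mul_grad_comm_F mul_grad_comm_B norm_commLetterF_le norm_commLetterB_le)
open Literature.MathematicalPhysics.QuantumFieldTheory.Balaban1983to89.B9Eq352DivForm (tauB)
open Literature.MathematicalPhysics.QuantumFieldTheory.Balaban1983to89.B9Eq352GradLetters (coefLetter diffLetter V0op V1pOp
  coefLetter_inl coefLetter_inr diffLetter_inl diffLetter_inr conj_V1pOp_eq_divForm)
open Literature.MathematicalPhysics.QuantumFieldTheory.Balaban1983to89.B9Eq360VprimeLetters (vPrimeConc vPrimeConc_eq avgOp)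
open Literature.MathematicalPhysics.QuantumFieldTheory.Balaban1983to89.B9Ineq386CommSum (divForm_of_gradForm_sum)
open Literature.MathematicalPhysics.QuantumFieldTheory.Balaban1983to89.B9Ineq361L2Letters (hasL2Majorant_conj_of_local
  hasL2Majorant_coefLetter hasL2Majorant_V0_vPrime hasL2Majorant_neg hasL2Majorant_sub)
open Literature.MathematicalPhysics.QuantumFieldTheory.Balaban1983to89.B9Ineq363L2 (hasL2Majorant_finsetSum
  hasL2Majorant_sum_const hasL2Majorant_rate_mono hasL2Majorant_comp_decay cVL2 cVL2_nonneg)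
open Literature.MathematicalPhysics.QuantumFieldTheory.Balaban1983to89.B6RandomWalkL2ChainLeft
  (l2Majorant_rightEntry_of_leftFixedPoint)

/-! ## §1  The commutator letters `[V¹_k, ∇_k]` of (3.52) in block-ℓ² form -/

section CommLetters

variable {𝔸 : Type*} [NormedRing 𝔸] [NormedAlgebra ℂ 𝔸] {ι : Type} [Fintype ι] [DecidableEq ι]
variable (b : Module.Basis ι ℝ 𝔸) {S : Type} [Fintype S] [DecidableEq S] {κ : Type}
variable (T : κ → Equiv.Perm S) (U : κ → S → 𝔸ˣ)
variable {g : B9.Geometry} [Fintype g.Site] {Rr : ℝ} {H : Prop}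

/-- **The forward commutator letter in ℓ²** (twin of `B9Eq352DivFormLetters.hasMajorant_commLetterF`): with the coefficient differences bounded
blockwise (`‖(c·D¹_μa)(x)‖ ≦ gf(y)` for `x ∈ Δ(y)`, `gf ≧ 0`), transports of size `≦ ρ`, the shifted point in a block at `d`-distance `≦ d₀` and the
coordinate bound `M₂`: `conj b (commLetterF c μ a)` has the BLOCK-ℓ² majorant `2ρ²gf(y)·M₂(Σ_i‖b_i‖)·√#ι·e^{δd₀}·e^{−δd(y,y′)}` — a one-point stencil
(`x ↦ x + e_μ`, multiplicity 1), `B9Ineq361L2Letters.hasL2Majorant_conj_of_local`.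
[cite: Balaban1985BackgroundPropagators, (3.37) p.396 + (3.52) p.400 + (3.61) p.402; Balaban1984PropagatorsII, (2.51) p.232 + Prop. 2.6 (2.140) p.247; derivation ours] -/
theorem hasL2Majorant_commLetterF (blk : S → g.Site) (c : ℂ) (μ : κ) (a : S → 𝔸) (gf : g.Site → ℝ) (ρ d₀ δ M₂ : ℝ)
    (hgf : ∀ y, 0 ≤ gf y) (hδ : 0 ≤ δ) (hM₂ : 0 ≤ M₂) (hrepr : ∀ (v : 𝔸) (i : ι), |b.repr v i| ≤ M₂ * ‖v‖)
    (hg : ∀ x, ‖c • covD T U μ a x‖ ≤ gf (blk x))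
    (hρ : ∀ x, ‖((U μ x : 𝔸ˣ) : 𝔸)‖ ≤ ρ ∧ ‖(((U μ x)⁻¹ : 𝔸ˣ) : 𝔸)‖ ≤ ρ)
    (hd₀ : ∀ x, g.dist (blk x) (blk (T μ x)) ≤ d₀) :
    HasL2Majorant (g := toB6 g Rr H) (fun p : S × ι => blk p.1) (conj b (commLetterF T U c μ a))
      (fun y y' => (2 * ρ ^ 2 * gf y) * (M₂ * ∑ i, ‖b i‖) * Real.sqrt ((1 * Fintype.card ι : ℕ) : ℝ) * Real.exp (δ * d₀) *
        Real.exp (-(δ * g.dist y y'))) := by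
  refine hasL2Majorant_conj_of_local (Rr := Rr) (H := H) b blk (fun x x' => x' = T μ x) (fun y => 2 * ρ ^ 2 * gf y) d₀ δ M₂ 1
    (fun y => by have := hgf y; positivity) hδ hM₂ hrepr (fun x x' hx' => by rw [hx']; exact hd₀ x)
    (fun x' => ⟨{(T μ).symm x'}, by simp, fun x hx => by rw [Finset.mem_singleton, hx, Equiv.symm_apply_apply]⟩)
    (commLetterF T U c μ a) ?_
  intro f x B hB
  have hB' : ‖f (T μ x)‖ ≤ B := hB (T μ x) rfl
  calc ‖commLetterF T U c μ a f x‖ ≤ 2 * ρ ^ 2 * gf (blk x) * ‖f (T μ x)‖ :=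
        norm_commLetterF_le T U c μ a f x (hg x) (hρ x).1 (hρ x).2
    _ ≤ 2 * ρ ^ 2 * gf (blk x) * B := by
        have : 0 ≤ 2 * ρ ^ 2 * gf (blk x) := by have := hgf (blk x); positivity
        exact mul_le_mul_of_nonneg_left hB' this

/-- **The backward commutator letter in ℓ²** (twin of `B9Eq352DivFormLetters.hasMajorant_commLetterB`; stencil `x − e_μ`, transports `U_μ(x−e_μ)⁻¹`).
[cite: Balaban1985BackgroundPropagators, (3.37) p.396 + (3.52) p.400 + (3.61) p.402; Balaban1984PropagatorsII, (2.51) p.232 + Prop. 2.6 (2.140) p.247; derivation ours] -/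
theorem hasL2Majorant_commLetterB (blk : S → g.Site) (c : ℂ) (μ : κ) (a : S → 𝔸) (gf : g.Site → ℝ) (ρ d₀ δ M₂ : ℝ)
    (hgf : ∀ y, 0 ≤ gf y) (hδ : 0 ≤ δ) (hM₂ : 0 ≤ M₂) (hrepr : ∀ (v : 𝔸) (i : ι), |b.repr v i| ≤ M₂ * ‖v‖)
    (hg : ∀ x, ‖c • covDstar T U μ a x‖ ≤ gf (blk x))
    (hρ : ∀ x, ‖(((U μ ((T μ).symm x))⁻¹ : 𝔸ˣ) : 𝔸)‖ ≤ ρ ∧ ‖((((U μ ((T μ).symm x))⁻¹)⁻¹ : 𝔸ˣ) : 𝔸)‖ ≤ ρ)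
    (hd₀ : ∀ x, g.dist (blk x) (blk ((T μ).symm x)) ≤ d₀) :
    HasL2Majorant (g := toB6 g Rr H) (fun p : S × ι => blk p.1) (conj b (commLetterB T U c μ a))
      (fun y y' => (2 * ρ ^ 2 * gf y) * (M₂ * ∑ i, ‖b i‖) * Real.sqrt ((1 * Fintype.card ι : ℕ) : ℝ) * Real.exp (δ * d₀) *
        Real.exp (-(δ * g.dist y y'))) := by
  refine hasL2Majorant_conj_of_local (Rr := Rr) (H := H) b blk (fun x x' => x' = (T μ).symm x) (fun y => 2 * ρ ^ 2 * gf y) d₀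
    δ M₂ 1 (fun y => by have := hgf y; positivity) hδ hM₂ hrepr (fun x x' hx' => by rw [hx']; exact hd₀ x)
    (fun x' => ⟨{T μ x'}, by simp, fun x hx => by rw [Finset.mem_singleton, hx, Equiv.apply_symm_apply]⟩)
    (commLetterB T U c μ a) ?_
  intro f x B hB
  have hB' : ‖f ((T μ).symm x)‖ ≤ B := hB ((T μ).symm x) rfl
  calc ‖commLetterB T U c μ a f x‖ ≤ 2 * ρ ^ 2 * gf (blk x) * ‖f ((T μ).symm x)‖ :=
        norm_commLetterB_le T U c μ a f x (hg x) (hρ x).1 (hρ x).2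
    _ ≤ 2 * ρ ^ 2 * gf (blk x) * B := by
        have : 0 ≤ 2 * ρ ^ 2 * gf (blk x) := by have := hgf (blk x); positivity
        exact mul_le_mul_of_nonneg_left hB' this

/-- **`hComm k` IN ℓ² FOR THE CONCRETE LETTER FAMILIES** (twin of `B9Eq352GradLetters.hasMajorant_comm_coefLetter_diffLetter`, both orientations):
under (3.37) read blockwise for the coefficient differences (`‖η⁻¹D¹_μA_μ(x)‖, ‖η⁻¹D¹*_μτ*_μA_μ(x)‖ ≦ α₁ℓ⁻²`), transports `≦ ρ`, stencil blocks within `d₀`: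
`conj b (V¹_k)·conj b (∇_k) − conj b (∇_k)·conj b (V¹_k) ≺₂ 2ρ²M₂(Σ_i‖b_i‖)√#ι e^{δd₀}·α₁·ℓ⁻²·e^{−δd}` for every `k ∈ κ ⊕ κ` — the lattice Leibniz
defect is a ONE-POINT-STENCIL letter, so its ℓ² size is its sup size.
[cite: Balaban1985BackgroundPropagators, (3.37) p.396 + (3.52) p.400 + (3.73) p.405; Balaban1985RegularSpaces, (1.87) p.91; Balaban1984PropagatorsII, (2.51) p.232 + Prop. 2.6 (2.140) p.247] -/
theorem hasL2Majorant_comm_coefLetter_diffLetter (blk : S → g.Site) (η : ℝ) (A : κ → S → 𝔸) (ρ d₀ δ M₂ α₁ : ℝ)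
    (hα₁ : 0 ≤ α₁) (hδ : 0 ≤ δ) (hM₂ : 0 ≤ M₂) (hrepr : ∀ (v : 𝔸) (i : ι), |b.repr v i| ≤ M₂ * ‖v‖)
    (h337F : ∀ μ x, ‖((η : ℂ)⁻¹) • covD T U μ (A μ) x‖ ≤ α₁ * (g.len (blk x) ^ 2)⁻¹)
    (h337B : ∀ μ x, ‖((η : ℂ)⁻¹) • covDstar T U μ (tauB T U μ (A μ)) x‖ ≤ α₁ * (g.len (blk x) ^ 2)⁻¹)
    (hρ : ∀ μ x, ‖((U μ x : 𝔸ˣ) : 𝔸)‖ ≤ ρ ∧ ‖(((U μ x)⁻¹ : 𝔸ˣ) : 𝔸)‖ ≤ ρ)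
    (hd₀ : ∀ μ x, g.dist (blk x) (blk (T μ x)) ≤ d₀ ∧ g.dist (blk x) (blk ((T μ).symm x)) ≤ d₀) (k : κ ⊕ κ) :
    HasL2Majorant (g := toB6 g Rr H) (fun p : S × ι => blk p.1)
      (conj b (coefLetter T U A k) * conj b (diffLetter T U ((η : ℂ)⁻¹) k)
        - conj b (diffLetter T U ((η : ℂ)⁻¹) k) * conj b (coefLetter T U A k))
      (fun y y' => (2 * ρ ^ 2 * M₂ * (∑ i, ‖b i‖) * Real.sqrt ((1 * Fintype.card ι : ℕ) : ℝ) * Real.exp (δ * d₀)) * α₁ *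
        (g.len y ^ 2)⁻¹ * Real.exp (-(δ * g.dist y y'))) := by
  have hgf : ∀ y : g.Site, 0 ≤ α₁ * (g.len y ^ 2)⁻¹ := fun y => mul_nonneg hα₁ (inv_nonneg.mpr (sq_nonneg _))
  cases k with
  | inl μ =>
      rw [coefLetter_inl, diffLetter_inl]
      have hop : conj b (mulLetter (A μ)) * conj b (gradLetterF T U ((η : ℂ)⁻¹) μ)
          - conj b (gradLetterF T U ((η : ℂ)⁻¹) μ) * conj b (mulLetter (A μ))
          = -conj b (commLetterF T U ((η : ℂ)⁻¹) μ (A μ)) := by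
        rw [← B9Eq352DivFormLetters.conj_mul, ← B9Eq352DivFormLetters.conj_mul, ← conj_sub, mul_grad_comm_F, conj_neg]
      rw [hop]
      have h := hasL2Majorant_commLetterF (Rr := Rr) (H := H) b T U blk ((η : ℂ)⁻¹) μ (A μ) (fun y => α₁ * (g.len y ^ 2)⁻¹)
        ρ d₀ δ M₂ hgf hδ hM₂ hrepr (h337F μ) (hρ μ) fun x => (hd₀ μ x).1
      refine hasL2Majorant_mono (g := toB6 g Rr H) _ (hasL2Majorant_neg (Rr := Rr) (H := H) _ h) fun y y' => le_of_eq ?_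
      change g.Site at y y'
      ring
  | inr μ =>
      rw [coefLetter_inr, diffLetter_inr, conj_neg]
      have e : conj b (mulLetter (tauB T U μ (A μ))) * conj b (gradLetterB T U ((η : ℂ)⁻¹) μ)
          - conj b (gradLetterB T U ((η : ℂ)⁻¹) μ) * conj b (mulLetter (tauB T U μ (A μ)))
          = -conj b (commLetterB T U ((η : ℂ)⁻¹) μ (tauB T U μ (A μ))) := by
        rw [← B9Eq352DivFormLetters.conj_mul, ← B9Eq352DivFormLetters.conj_mul, ← conj_sub, mul_grad_comm_B, conj_neg]
      have hop : conj b (mulLetter (tauB T U μ (A μ))) * -conj b (gradLetterB T U ((η : ℂ)⁻¹) μ)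
          - -conj b (gradLetterB T U ((η : ℂ)⁻¹) μ) * conj b (mulLetter (tauB T U μ (A μ)))
          = -(conj b (mulLetter (tauB T U μ (A μ))) * conj b (gradLetterB T U ((η : ℂ)⁻¹) μ)
              - conj b (gradLetterB T U ((η : ℂ)⁻¹) μ) * conj b (mulLetter (tauB T U μ (A μ)))) := by
        refine LinearMap.ext fun f => funext fun p => ?_
        simp only [LinearMap.sub_apply, LinearMap.neg_apply, Module.End.mul_apply, map_neg, Pi.sub_apply, Pi.neg_apply]
        ring
      rw [hop, e, neg_neg]
      have h := hasL2Majorant_commLetterB (Rr := Rr) (H := H) b T U blk ((η : ℂ)⁻¹) μ (tauB T U μ (A μ))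
        (fun y => α₁ * (g.len y ^ 2)⁻¹) ρ d₀ δ M₂ hgf hδ hM₂ hrepr (h337B μ)
        (fun x => ⟨(hρ μ ((T μ).symm x)).2, by rw [inv_inv]; exact (hρ μ ((T μ).symm x)).1⟩) fun x => (hd₀ μ x).2
      refine hasL2Majorant_mono (g := toB6 g Rr H) _ h fun y y' => le_of_eq ?_
      change g.Site at y y'
      ring

end CommLetters

/-! ## §2  `G′(U)·V` in block-ℓ² form for a first-order `V` in finite-sum divergence ∕ gradient-plus-commutator form -/

section Abstract

variable {g : B9.Geometry} [Fintype g.Site] {R : ℝ} {H : Prop} {W : Type} [Fintype W] {K : Type}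

/-- **`G′(U)V ≺₂ B₀Λc₁(β)(Σ_kc_{B,k} + c_V)·α₁·e^{−ρd}` FROM THE DIVERGENCE FORM, SUMMED, IN ℓ²** (twin of
`B9Ineq386CommSum.hasMajorant_GV_of_divForm_sum` with `P₁ = P₂ = 0`): `V = Σ_{k∈s} ∇♯_kB_k + C₃`, `B_k ≺₂ c_{B,k}α₁(Lʲη)⁻¹e^{−δd}`,
`C₃ ≺₂ c_Vα₁(Lʲη)⁻²e^{−δd}`, Theorem 3.1's `L²` members at U `G′ ≺₂ B₀(Lʲη)²e^{−δd}` ((3.46)₀) and `G′∇♯_k ≺₂ B₀Lʲη e^{−δd}` per letter ((3.46)₂), the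
scale transfers of the INVERSE weights `(Lʲη)⁻¹`, `(Lʲη)⁻²` at exponent `α` (constant `Λ`), (2.61) at `β` and (2.54); words `(G′∇♯_k)B_k`, `G′C₃`.
[cite: Balaban1985BackgroundPropagators, (3.46) p.398 + (3.61)–(3.63) p.402 + (3.70)–(3.73) pp.404–405 + p.398 (remarks); Balaban1984PropagatorsII, Lemma 2.1 p.234 + (2.52)–(2.55) p.232 + Prop. 2.6 (2.140)–(2.141) p.247] -/
theorem hasL2Majorant_GV_of_divForm_sum_l2 (blk : W → g.Site) (d : ℕ) (s : Finset K)
    (δ₀ δ α β ρ Λ B₀ cV α₁ : ℝ) (cB : K → ℝ)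
    (hB₀ : 0 ≤ B₀) (hcV : 0 ≤ cV) (hα₁ : 0 ≤ α₁) (hΛ : 0 ≤ Λ) (hρ : 0 ≤ ρ) (hα : 0 ≤ α) (hβ : 0 ≤ β) (hδ₀ : 0 ≤ δ₀)
    (hr : ρ + (α + β) * δ₀ ≤ δ) (hcB : ∀ k ∈ s, 0 ≤ cB k)
    (hdnn : ∀ a b : g.Site, 0 ≤ g.dist a b) (htri : Triangle254 (toB6 g R H)) (hlen : ∀ y : g.Site, 0 < g.len y)
    (h261 : Ineq261 d (toB6 g R H) δ₀ β)
    (hT1i : ScaleTransfer g δ₀ α Λ (fun a => (g.len a)⁻¹)) (hT2i : ScaleTransfer g δ₀ α Λ (fun a => (g.len a ^ 2)⁻¹))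
    {G V C₃ : Module.End ℝ (W → ℝ)} {Dv B : K → Module.End ℝ (W → ℝ)} (hVdiv : V = ∑ k ∈ s, Dv k * B k + C₃)
    (hB : ∀ k ∈ s, HasL2Majorant (g := toB6 g R H) blk (B k)
      (fun a b => cB k * α₁ * (g.len a)⁻¹ * Real.exp (-(δ * g.dist a b))))
    (hC₃ : HasL2Majorant (g := toB6 g R H) blk C₃
      (fun a b => cV * α₁ * (g.len a ^ 2)⁻¹ * Real.exp (-(δ * g.dist a b))))
    (hG : HasL2Majorant (g := toB6 g R H) blk G (fun a b => B₀ * g.len a ^ 2 * Real.exp (-(δ * g.dist a b))))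
    (hGDv : ∀ k ∈ s, HasL2Majorant (g := toB6 g R H) blk (G * Dv k)
      (fun a b => B₀ * g.len a * Real.exp (-(δ * g.dist a b)))) :
    HasL2Majorant (g := toB6 g R H) blk (G * V)
      (fun a b => (B₀ * Λ * B6.c1 d δ₀ β * (∑ k ∈ s, cB k + cV)) * α₁ * Real.exp (-(ρ * g.dist a b))) := by
  set c : ℝ := B6.c1 d δ₀ β with hc_def
  have hc0 : 0 ≤ c := B6RandomWalk.c1_nonneg d δ₀ β
  have hw1 : ∀ a : g.Site, 0 ≤ g.len a := fun a => (hlen a).le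
  have hw2 : ∀ a : g.Site, 0 ≤ g.len a ^ 2 := fun a => sq_nonneg _
  have hw1i : ∀ a : g.Site, 0 ≤ (g.len a)⁻¹ := fun a => inv_nonneg.mpr (hlen a).le
  have hw2i : ∀ a : g.Site, 0 ≤ (g.len a ^ 2)⁻¹ := fun a => inv_nonneg.mpr (sq_nonneg _)
  have hcVα : 0 ≤ cV * α₁ := mul_nonneg hcV hα₁
  have hρδ : ρ ≤ δ := by
    have : 0 ≤ (α + β) * δ₀ := by positivity
    linarith
  -- the word G′C₃
  have hC₃ρ := hasL2Majorant_rate_mono (R := R) (H := H) blk (cV * α₁) (fun a => (g.len a ^ 2)⁻¹) hcVα hw2i hρδ hdnn hC₃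
  have w2 := hasL2Majorant_comp_decay (R := R) (H := H) blk d δ₀ α β ρ δ Λ B₀ (cV * α₁) (fun a => g.len a ^ 2)
    (fun a => (g.len a ^ 2)⁻¹) hw2 hw2i hΛ hB₀ hcVα hρ hr hdnn htri hT2i h261 hG hC₃ρ
  -- the words (G′∇♯_k)B_k, summed
  have w1k : ∀ k ∈ s, HasL2Majorant (g := toB6 g R H) blk (G * Dv k * B k)
      (fun a b => (cB k * α₁ * B₀ * Λ * c) * ((g.len a * (g.len a)⁻¹) * Real.exp (-(ρ * g.dist a b)))) := by
    intro k hk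
    have hBρ := hasL2Majorant_rate_mono (R := R) (H := H) blk (cB k * α₁) (fun a => (g.len a)⁻¹)
      (mul_nonneg (hcB k hk) hα₁) hw1i hρδ hdnn (hB k hk)
    have h := hasL2Majorant_comp_decay (R := R) (H := H) blk d δ₀ α β ρ δ Λ B₀ (cB k * α₁) (fun a => g.len a)
      (fun a => (g.len a)⁻¹) hw1 hw1i hΛ hB₀ (mul_nonneg (hcB k hk) hα₁) hρ hr hdnn htri hT1i h261 (hGDv k hk) hBρ
    exact hasL2Majorant_mono (g := toB6 g R H) blk h fun a b => le_of_eq (by rw [← hc_def]; ring)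
  have w1 := hasL2Majorant_sum_const (R := R) (H := H) blk s (fun k => cB k * α₁ * B₀ * Λ * c)
    (fun a b => (g.len a * (g.len a)⁻¹) * Real.exp (-(ρ * g.dist a b))) w1k
  have hsum' := hasL2Majorant_add (g := toB6 g R H) blk w1 w2
  have e : G * V = (∑ k ∈ s, G * Dv k * B k) + G * C₃ := by
    rw [hVdiv]
    simp only [mul_add, Finset.mul_sum, mul_assoc]
  rw [e]
  refine hasL2Majorant_mono (g := toB6 g R H) blk hsum' fun a b => le_of_eq ?_
  have ha : g.len a ≠ 0 := (hlen a).ne'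
  have h1 : g.len a * (g.len a)⁻¹ = 1 := mul_inv_cancel₀ ha
  have h2 : g.len a ^ 2 * (g.len a ^ 2)⁻¹ = 1 := mul_inv_cancel₀ (pow_ne_zero 2 ha)
  rw [h1, h2, ← Finset.sum_mul, ← Finset.sum_mul, ← Finset.sum_mul, ← Finset.sum_mul, hc_def]
  ring

/-- **The zeroth-order letter of the divergence form, summed, in ℓ²** (twin of `B9Ineq386CommSum.hasMajorant_C₃_of_comm_sum`): `V⁰ ≺₂ c_Vα₁(Lʲη)⁻²e^{−δd}`
and `V¹_k∇_k − ∇_kV¹_k ≺₂ c_{K,k}α₁(Lʲη)⁻²e^{−δd}` give `V⁰ + Σ_k [V¹_k, ∇_k] ≺₂ (c_V + Σ_kc_{K,k})α₁(Lʲη)⁻²e^{−δd}`.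
[cite: Balaban1985BackgroundPropagators, (3.73) p.405 + (3.37) p.396; Balaban1984PropagatorsII, (2.52) p.232 + Prop. 2.6 (2.140) p.247] -/
theorem hasL2Majorant_C₃_of_comm_sum_l2 (blk : W → g.Site) (s : Finset K) (δ cV α₁ : ℝ) (cK : K → ℝ)
    {V0 : Module.End ℝ (W → ℝ)} {V1 D : K → Module.End ℝ (W → ℝ)}
    (hV0 : HasL2Majorant (g := toB6 g R H) blk V0
      (fun a b => cV * α₁ * (g.len a ^ 2)⁻¹ * Real.exp (-(δ * g.dist a b))))
    (hComm : ∀ k ∈ s, HasL2Majorant (g := toB6 g R H) blk (V1 k * D k - D k * V1 k)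
      (fun a b => cK k * α₁ * (g.len a ^ 2)⁻¹ * Real.exp (-(δ * g.dist a b)))) :
    HasL2Majorant (g := toB6 g R H) blk (V0 + ∑ k ∈ s, (V1 k * D k - D k * V1 k))
      (fun a b => (cV + ∑ k ∈ s, cK k) * α₁ * (g.len a ^ 2)⁻¹ * Real.exp (-(δ * g.dist a b))) := by
  have hS := hasL2Majorant_sum_const (R := R) (H := H) blk s cK
    (fun a b => α₁ * (g.len a ^ 2)⁻¹ * Real.exp (-(δ * g.dist a b)))
    (T := fun k => V1 k * D k - D k * V1 k)
    (fun k hk => hasL2Majorant_mono (g := toB6 g R H) blk (hComm k hk) fun a b => le_of_eq (by ring))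
  refine hasL2Majorant_mono (g := toB6 g R H) blk (hasL2Majorant_add (g := toB6 g R H) blk hV0 hS) fun a b => le_of_eq ?_
  ring

/-- **`G′(U)V ≺₂ B₀Λc₁(β)(Σ_kc_{1,k} + c_V + Σ_kc_{K,k})·α₁·e^{−ρd}` FROM THE GRADIENT FORM AND THE COMMUTATOR LETTERS, SUMMED, IN ℓ²** (twin of
`B9Ineq386CommSum.hasMajorant_GV_of_gradForm_comm_sum`): `V = V⁰ + Σ_{k∈s}V¹_k∇_k` is rewritten `Σ_k∇_kV¹_k + (V⁰ + Σ_k[V¹_k, ∇_k])`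
(`divForm_of_gradForm_sum` BY NAME) and §2's divergence-form bound applies with `B_k = V¹_k`, `C₃ = V⁰ + Σ_k[V¹_k, ∇_k]`.
[cite: Balaban1985BackgroundPropagators, (3.46) p.398 + (3.61)–(3.63) p.402 + (3.70)–(3.73) pp.404–405 + (3.37) p.396 + p.398 (remarks); Balaban1984PropagatorsII, Lemma 2.1 p.234 + (2.52)–(2.55) p.232 + Prop. 2.6 (2.140)–(2.141) p.247] -/
theorem hasL2Majorant_GV_of_gradForm_comm_sum_l2 (blk : W → g.Site) (d : ℕ) (s : Finset K)
    (δ₀ δ α β ρ Λ B₀ cV α₁ : ℝ) (c1 cK : K → ℝ)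
    (hB₀ : 0 ≤ B₀) (hcV : 0 ≤ cV) (hα₁ : 0 ≤ α₁) (hΛ : 0 ≤ Λ) (hρ : 0 ≤ ρ) (hα : 0 ≤ α) (hβ : 0 ≤ β) (hδ₀ : 0 ≤ δ₀)
    (hr : ρ + (α + β) * δ₀ ≤ δ) (hc1 : ∀ k ∈ s, 0 ≤ c1 k) (hcK : ∀ k ∈ s, 0 ≤ cK k)
    (hdnn : ∀ a b : g.Site, 0 ≤ g.dist a b) (htri : Triangle254 (toB6 g R H)) (hlen : ∀ y : g.Site, 0 < g.len y)
    (h261 : Ineq261 d (toB6 g R H) δ₀ β)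
    (hT1i : ScaleTransfer g δ₀ α Λ (fun a => (g.len a)⁻¹)) (hT2i : ScaleTransfer g δ₀ α Λ (fun a => (g.len a ^ 2)⁻¹))
    {G V V0 : Module.End ℝ (W → ℝ)} {V1 D : K → Module.End ℝ (W → ℝ)} (hVg : V = V0 + ∑ k ∈ s, V1 k * D k)
    (hV0 : HasL2Majorant (g := toB6 g R H) blk V0
      (fun a b => cV * α₁ * (g.len a ^ 2)⁻¹ * Real.exp (-(δ * g.dist a b))))
    (hV1 : ∀ k ∈ s, HasL2Majorant (g := toB6 g R H) blk (V1 k)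
      (fun a b => c1 k * α₁ * (g.len a)⁻¹ * Real.exp (-(δ * g.dist a b))))
    (hComm : ∀ k ∈ s, HasL2Majorant (g := toB6 g R H) blk (V1 k * D k - D k * V1 k)
      (fun a b => cK k * α₁ * (g.len a ^ 2)⁻¹ * Real.exp (-(δ * g.dist a b))))
    (hG : HasL2Majorant (g := toB6 g R H) blk G (fun a b => B₀ * g.len a ^ 2 * Real.exp (-(δ * g.dist a b))))
    (hGD : ∀ k ∈ s, HasL2Majorant (g := toB6 g R H) blk (G * D k)
      (fun a b => B₀ * g.len a * Real.exp (-(δ * g.dist a b)))) :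
    HasL2Majorant (g := toB6 g R H) blk (G * V)
      (fun a b => (B₀ * Λ * B6.c1 d δ₀ β * (∑ k ∈ s, c1 k + (cV + ∑ k ∈ s, cK k))) * α₁ * Real.exp (-(ρ * g.dist a b))) := by
  have hSK : 0 ≤ ∑ k ∈ s, cK k := Finset.sum_nonneg hcK
  have hC₃ := hasL2Majorant_C₃_of_comm_sum_l2 (R := R) (H := H) blk s δ cV α₁ cK hV0 hComm
  exact hasL2Majorant_GV_of_divForm_sum_l2 (R := R) (H := H) blk d s δ₀ δ α β ρ Λ B₀ (cV + ∑ k ∈ s, cK k) α₁ c1 hB₀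
    (add_nonneg hcV hSK) hα₁ hΛ hρ hα hβ hδ₀ hr hc1 hdnn htri hlen h261 hT1i hT2i (divForm_of_gradForm_sum s hVg) hV1 hC₃ hG hGD

end Abstract

/-! ## §3  `G′(U)·V′(A)` in block-ℓ² form for the CONCRETE `V′(A)` of (3.60) -/

section Concrete

variable {𝔸 : Type*} [NormedRing 𝔸] [NormedAlgebra ℂ 𝔸] [CompleteSpace 𝔸] {ι : Type} [Fintype ι] [DecidableEq ι]
variable (b : Module.Basis ι ℝ 𝔸) {S : Type} [Fintype S] [DecidableEq S] {κ : Type} [Fintype κ]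
variable (T : κ → Equiv.Perm S) (U : κ → S → 𝔸ˣ)
variable {g : B9.Geometry} [Fintype g.Site] [DecidableEq g.Site] {Rr : ℝ} {H : Prop}

/-- ★ **THE LEFT COMPOSITE `G′(U)·V′(A)` IN THE `L²` NORMS, FOR THE CONCRETE `V′(A)` OF (3.60)** (the `L²` twin of `B9Ineq363Vprime.hasMajorant_gp_vPrime`,
the companion of the `L²` (3.63) `B9Ineq363L2.ineq363_l2_vPrime` needed by the RIGHT entries of (3.46) for `G′(U′U)`, p. 403 l. 1–9): after real
coordinates `G′(U)·conj b V′(A) ≺₂ θ_R·e^{−ρd}`, `θ_R = B₀Λc₁(β)·(cVL2 + 2|κ|·2ρu²M₂(Σ‖b‖)√#ι e^{δd₀})·α₁` EXPLICIT.  INPUTS: (3.37) read blockwise for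
the letters of `V′₁(A)` (sizes AND coefficient differences), transports `≦ ρu`, `ηα₁ℓ⁻¹ ≦ 1/4`, the stencil geometry, the (3.19)/(3.58)/(3.24) bounds
of the averaging letters (`#Δ(y)·w(y) ≦ 1`), the coordinate bound `M₂`; THEOREM 3.1 FOR `G′(U)` IN ITS `L²` FORM: (3.46)₀ `G′ ≺₂ B₀(Lʲη)²e^{−δd}` and
the RIGHT members (3.46)₂ `G′∇♯_k ≺₂ B₀Lʲη e^{−δd}` for each concrete difference letter (both orientations, «we may always replace ∇_U by ∇*_U»,
p. 398); Lemma 2.1 of [4] (scale transfers of the inverse weights at `α`, (2.61) at `β`, (2.54)).  Route: `conj_V1pOp_eq_divForm` (lattice Leibniz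
rule) + §1 + §2. [cite: Balaban1985BackgroundPropagators, (3.46) p.398 + (3.60)–(3.63) p.402 + (3.52) p.400 + (3.73) p.405 + (3.37) p.396 + p.398 (remarks) + p.403 l.1–9; Balaban1984PropagatorsII, Lemma 2.1 p.234 + Prop. 2.6 (2.140)–(2.141) p.247] -/
theorem hasL2Majorant_gp_vPrime (blk : S → g.Site) (d : ℕ) {η : ℝ} (hη : 0 < η) (A : κ → S → 𝔸)
    (kQ kF : g.Site → S → 𝔸 →L[ℝ] 𝔸) (sQ sF : S → 𝔸 →L[ℝ] 𝔸) (c w : g.Site → ℝ) (ρu d₀ M₂ C a₀ : ℝ)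
    (δ₀ δ α β ρ Λ B₀ α₁ : ℝ)
    (hB₀ : 0 ≤ B₀) (hα₁ : 0 ≤ α₁) (hΛ : 0 ≤ Λ) (hρ : 0 ≤ ρ) (hα : 0 ≤ α) (hβ : 0 ≤ β) (hδ₀ : 0 ≤ δ₀) (hδ : 0 ≤ δ)
    (hr : ρ + (α + β) * δ₀ ≤ δ)
    (hdnn : ∀ a a' : g.Site, 0 ≤ g.dist a a') (htri : Triangle254 (toB6 g Rr H)) (hlen : ∀ y : g.Site, 0 < g.len y)
    (h261 : Ineq261 d (toB6 g Rr H) δ₀ β)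
    (hT1i : ScaleTransfer g δ₀ α Λ (fun a => (g.len a)⁻¹)) (hT2i : ScaleTransfer g δ₀ α Λ (fun a => (g.len a ^ 2)⁻¹))
    (hM₂ : 0 ≤ M₂) (hrepr : ∀ (v : 𝔸) (i : ι), |b.repr v i| ≤ M₂ * ‖v‖)
    (hsmall : ∀ y : g.Site, η * (α₁ * (g.len y)⁻¹) ≤ 1 / 4)
    (hA : ∀ μ x, ‖A μ x‖ ≤ α₁ * (g.len (blk x))⁻¹ ∧ ‖tauB T U μ (A μ) x‖ ≤ α₁ * (g.len (blk x))⁻¹)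
    (h337s : ∀ μ x, ‖((η : ℂ)⁻¹) • covDstar T U μ (A μ) x‖ ≤ α₁ * (g.len (blk x) ^ 2)⁻¹)
    (h337F : ∀ μ x, ‖((η : ℂ)⁻¹) • covD T U μ (A μ) x‖ ≤ α₁ * (g.len (blk x) ^ 2)⁻¹)
    (h337B : ∀ μ x, ‖((η : ℂ)⁻¹) • covDstar T U μ (tauB T U μ (A μ)) x‖ ≤ α₁ * (g.len (blk x) ^ 2)⁻¹)
    (hρu : ∀ μ x, ‖((U μ x : 𝔸ˣ) : 𝔸)‖ ≤ ρu ∧ ‖(((U μ x)⁻¹ : 𝔸ˣ) : 𝔸)‖ ≤ ρu)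
    (hd₀ : ∀ μ x, g.dist (blk x) (blk (T μ x)) ≤ d₀ ∧ g.dist (blk x) (blk ((T μ).symm x)) ≤ d₀)
    (hd₀0 : ∀ y : g.Site, g.dist y y ≤ d₀)
    (hw : ∀ y, 0 ≤ w y) (hcard : ∀ y, ((B9Eq360Vprime.block blk y).card : ℝ) * w y ≤ 1) (hC : 0 ≤ C) (ha₀ : 0 ≤ a₀)
    (hkQ : ∀ y x, blk x = y → ‖kQ y x‖ ≤ w y) (hkF : ∀ y x, blk x = y → ‖kF y x‖ ≤ C * α₁ * w y)
    (hsQ : ∀ x, ‖sQ x‖ ≤ 1) (hsF : ∀ x, ‖sF x‖ ≤ C * α₁) (hc : ∀ y, |c y| ≤ a₀ * (g.len y ^ 2)⁻¹)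
    {Gp : Module.End ℝ (S × ι → ℝ)}
    (h346_0 : HasL2Majorant (g := toB6 g Rr H) (fun p : S × ι => blk p.1) Gp
      (fun a a' => B₀ * g.len a ^ 2 * Real.exp (-(δ * g.dist a a'))))
    (h346_2 : ∀ k : κ ⊕ κ, HasL2Majorant (g := toB6 g Rr H) (fun p : S × ι => blk p.1)
      (Gp * conj b (diffLetter T U ((η : ℂ)⁻¹) k)) (fun a a' => B₀ * g.len a * Real.exp (-(δ * g.dist a a')))) :
    HasL2Majorant (g := toB6 g Rr H) (fun p : S × ι => blk p.1)
      (Gp * conj b (vPrimeConc T U η A blk kQ kF sQ sF c))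
      (fun a a' => (B₀ * Λ * B6.c1 d δ₀ β *
          (cVL2 (Fintype.card κ) (Fintype.card ι) ρu α₁ a₀ C M₂ (∑ i, ‖b i‖) (Real.sqrt (∑ i, ‖b i‖ ^ 2)) (Real.exp (δ * d₀)) +
            2 * Fintype.card κ * (2 * ρu ^ 2 * M₂ * (∑ i, ‖b i‖) * Real.sqrt ((1 * Fintype.card ι : ℕ) : ℝ) * Real.exp (δ * d₀)))) *
        α₁ * Real.exp (-(ρ * g.dist a a'))) := by
  have hSb : 0 ≤ ∑ i, ‖b i‖ := Finset.sum_nonneg fun i _ => norm_nonneg _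
  have hSb2 : 0 ≤ Real.sqrt (∑ i, ‖b i‖ ^ 2) := Real.sqrt_nonneg _
  have hE₀ : 0 ≤ Real.exp (δ * d₀) := Real.exp_nonneg _
  have hd : (0 : ℝ) ≤ Fintype.card κ := Nat.cast_nonneg _
  -- the three constants: zeroth order (after coordinates), coefficients, commutators
  set c0L : ℝ := ((2 + 8 * ρu ^ 2 * α₁) * Fintype.card κ * M₂ * (∑ i, ‖b i‖) *
        Real.sqrt (((2 * Fintype.card κ + 1) * Fintype.card ι : ℕ) : ℝ) +
      a₀ * C * (2 + C * α₁) * M₂ * Real.sqrt (Fintype.card ι) * Real.sqrt (∑ i, ‖b i‖ ^ 2)) * Real.exp (δ * d₀) with hc0L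
  set c1L : ℝ := 2 * M₂ * (∑ i, ‖b i‖) * Real.sqrt ((1 * Fintype.card ι : ℕ) : ℝ) * Real.exp (δ * d₀) with hc1L
  set cKL : ℝ := 2 * ρu ^ 2 * M₂ * (∑ i, ‖b i‖) * Real.sqrt ((1 * Fintype.card ι : ℕ) : ℝ) * Real.exp (δ * d₀) with hcKL
  have hc0L0 : 0 ≤ c0L := by rw [hc0L]; positivity
  have hc1L0 : 0 ≤ c1L := by rw [hc1L]; positivity
  have hcKL0 : 0 ≤ cKL := by rw [hcKL]; positivity
  have hcV_eq : cVL2 (Fintype.card κ) (Fintype.card ι) ρu α₁ a₀ C M₂ (∑ i, ‖b i‖) (Real.sqrt (∑ i, ‖b i‖ ^ 2))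
      (Real.exp (δ * d₀)) = c0L + 2 * Fintype.card κ * c1L := by
    rw [cVL2, hc0L, hc1L]
  -- the zeroth-order part INCLUDING the averaging operator: (conj V⁰ − conj avgOp)
  have hV0 : HasL2Majorant (g := toB6 g Rr H) (fun p : S × ι => blk p.1)
      (conj b (V0op T U η A) - conj b (avgOp blk kQ kF sQ sF c))
      (fun y y' => c0L * α₁ * (g.len y ^ 2)⁻¹ * Real.exp (-(δ * g.dist y y'))) := by
    simpa only [hc0L] using
      hasL2Majorant_V0_vPrime b T U blk hη A kQ kF sQ sF c w ρu d₀ δ M₂ α₁ C a₀ hα₁ hδ hM₂ hrepr hlen hsmall hA h337s hρu hd₀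
        hd₀0 hw hcard hC ha₀ hkQ hkF hsQ hsF hc
  -- the operator identity: G′·conj V′ with conj V′ = Σ_k ∇_kV¹_k + ((V⁰ − avg) + Σ_k [V¹_k, ∇_k])
  have hVg : conj b (vPrimeConc T U η A blk kQ kF sQ sF c)
      = (conj b (V0op T U η A) - conj b (avgOp blk kQ kF sQ sF c))
        + ∑ k ∈ (Finset.univ : Finset (κ ⊕ κ)), conj b (coefLetter T U A k) * conj b (diffLetter T U ((η : ℂ)⁻¹) k) := by
    rw [vPrimeConc_eq, conj_sub, B9Eq352GradLetters.conj_V1pOp_eq_gradForm]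
    abel
  have h := hasL2Majorant_GV_of_gradForm_comm_sum_l2 (R := Rr) (H := H) (fun p : S × ι => blk p.1) d
    (Finset.univ : Finset (κ ⊕ κ)) δ₀ δ α β ρ Λ B₀ c0L α₁ (fun _ => c1L) (fun _ => cKL) hB₀ hc0L0 hα₁ hΛ hρ hα hβ hδ₀ hr
    (fun _ _ => hc1L0) (fun _ _ => hcKL0) hdnn htri hlen h261 hT1i hT2i
    (V1 := fun k => conj b (coefLetter T U A k)) (D := fun k => conj b (diffLetter T U ((η : ℂ)⁻¹) k)) hVg hV0
    (fun k _ => by simpa only [hc1L] using hasL2Majorant_coefLetter b T U blk A d₀ δ M₂ α₁ hα₁ hδ hM₂ hrepr hlen hA hd₀0 k)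
    (fun k _ => by
      simpa only [hcKL] using
        hasL2Majorant_comm_coefLetter_diffLetter b T U blk η A ρu d₀ δ M₂ α₁ hα₁ hδ hM₂ hrepr h337F h337B hρu hd₀ k)
    h346_0 (fun k _ => h346_2 k)
  refine hasL2Majorant_mono (g := toB6 g Rr H) _ h fun a a' => le_of_eq ?_
  rw [Finset.sum_const, Finset.sum_const, Finset.card_univ, Fintype.card_sum, nsmul_eq_mul, nsmul_eq_mul, Nat.cast_add, hcV_eq]
  ring

end Concrete

/-! ## §4  The first form of (3.65) from the inverse identities, and the RIGHT (3.46)-entries of `G′(U′U)` by the left-routed walk -/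

section Extension

variable {g : B9.Geometry} [Fintype g.Site] {R : ℝ} {H : Prop} {W : Type} [Fintype W] [DecidableEq W]

omit [Fintype g.Site] [Fintype W] [DecidableEq W] in
/-- **The FIRST form of (3.65) IS ALGEBRA once `G′(U′U)` inverts `Δ′_a(U) − V′(A)` and `G′(U)` inverts `Δ′_a(U)`**:
`G′(U′U) = G′(U) + G′(U)·(V′(A)G′(U′U))` (multiply `(Δ′ − V′)G′(U′U) = 1` on the left by `G′(U)` and use `G′(U)Δ′ = 1`) — the left fixed point the
RIGHT entries are summed from, with no norm condition (companion of `B9Ineq363L2.eq365_of_inverse`, the second form).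
[cite: Balaban1985BackgroundPropagators, (3.62)–(3.65) p.402] -/
theorem eq365_first_of_inverse {A : Type*} [Ring A] {Δp Vp GpU GpExt : A} (hGΔ : GpU * Δp = 1) (hinv : (Δp - Vp) * GpExt = 1) :
    GpExt = GpU + GpU * (Vp * GpExt) := by
  have h : GpU * ((Δp - Vp) * GpExt) = GpU := by rw [hinv, mul_one]
  have h' : GpU * ((Δp - Vp) * GpExt) = GpU * Δp * GpExt - GpU * (Vp * GpExt) := by
    rw [sub_mul, mul_sub, mul_assoc]
  rw [h', hGΔ, one_mul] at h
  exact sub_eq_iff_eq_add.mp h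

/-- ★★ **THE RIGHT (3.46)-ENTRIES OF `G′(U′U)` BY THE LEFT-ROUTED ℓ²-SUMMED WALK, POWERS AT THE OUTPUT BLOCK** (p. 403 l. 1–9 «applying Theorem 3.1 for
G′(U), the bound (3.63), the representation (3.64) and Lemma 2.1 of [4]»; [4] p. 247 «convergent in the norms appearing in the inequalities»):
if `G′(U)·Y ≺₂ B·P(y)·e^{−δ₀d}` (an `L²` member of Theorem 3.1 at U for the RIGHT letter `Y` — `Y = ∇*_k`: (3.46)₂), `G′(U)V′(A) ≺₂ θ·e^{−δ₀d}` (§3),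
`G′(U′U) = G′(U) + G′(U)·(V′(A)G′(U′U))` (`eq365_first_of_inverse`), the p. 398 scale transfers of `P` at `(δ₀, α′)` (constant `Λ`) and at
`(δ₂, α″)` (constant `Λ′`), (2.61) at `(δ₁, α)` (`δ₁ = (1−α′)δ₀`, `δ₂ = (1−α)δ₁`) and the smallness `θc₁(δ₁,α) < 1`, then
`G′(U′U)·Y ≺₂ BΛc₁(1 − θc₁)⁻¹Λ′·P(y)·e^{−(1−α″)δ₂d}` — `B6RandomWalkL2ChainLeft.l2Majorant_rightEntry_of_leftFixedPoint` BY NAME on the left fixed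
point `G′(U′U)Y = G′(U)Y + (G′(U)V′)·(G′(U′U)Y)`.
[cite: Balaban1985BackgroundPropagators, (3.46) p.398 + p.398 (remarks) + (3.64)–(3.65) pp.402–403 + p.403 l.1–9; Balaban1984PropagatorsII, (2.66) p.234 + Prop. 2.6 (2.140)–(2.141) p.247 + Lemma 2.1 p.234] -/
theorem hasL2Majorant_rightEntry_gpExt (blk : W → g.Site) (d : ℕ) (δ₀ α' α α'' θ B Λ Λ' : ℝ) (P : g.Site → ℝ)
    (hB : 0 ≤ B) (hΛ : 0 ≤ Λ) (hP : ∀ y, 0 ≤ P y) (hθ : 0 ≤ θ) (hδ₀ : 0 ≤ δ₀) (hα'0 : 0 ≤ α') (hα'1 : α' ≤ 1) (hα1 : α ≤ 1)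
    (htri : Triangle254 (toB6 g R H)) (hrefl : ∀ y : g.Site, g.dist y y = 0)
    (hsym : ∀ y y' : g.Site, g.dist y y' = g.dist y' y) (hdnn : ∀ y y' : g.Site, 0 ≤ g.dist y y')
    (h261 : Ineq261 d (toB6 g R H) ((1 - α') * δ₀) α) (hsmall : θ * B6.c1 d ((1 - α') * δ₀) α < 1)
    (hT₁ : ScaleTransfer g δ₀ α' Λ P) (hT₂ : ScaleTransfer g ((1 - α) * ((1 - α') * δ₀)) α'' Λ' P)
    {GpU GpExt Vp Y : Module.End ℝ (W → ℝ)} (h365 : GpExt = GpU + GpU * (Vp * GpExt))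
    (hY : HasL2Majorant (g := toB6 g R H) blk (GpU * Y) (fun a b => B * P a * Real.exp (-(δ₀ * g.dist a b))))
    (hM : HasL2Majorant (g := toB6 g R H) blk (GpU * Vp) (fun a b => θ * Real.exp (-(δ₀ * g.dist a b)))) :
    HasL2Majorant (g := toB6 g R H) blk (GpExt * Y)
      (fun a b => B * Λ * B6.c1 d ((1 - α') * δ₀) α * (1 - θ * B6.c1 d ((1 - α') * δ₀) α)⁻¹ * Λ' * P a *
        Real.exp (-((1 - α'') * ((1 - α) * ((1 - α') * δ₀)) * g.dist a b))) := by
  have hfix : GpExt * Y = GpU * Y + GpU * Vp * (GpExt * Y) := by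
    conv_lhs => rw [h365]
    simp only [add_mul, mul_assoc]
  have htr₁ : ∀ a c : g.Site, Real.exp (-(α' * δ₀ * g.dist a c)) * P a ≤ Λ * P c := fun a c => by
    rw [hsym a c]; exact hT₁ c a
  have htr₂ : ∀ a c : g.Site, Real.exp (-(α'' * ((1 - α) * ((1 - α') * δ₀)) * g.dist a c)) * P c ≤ Λ' * P a :=
    fun a c => hT₂ a c
  exact l2Majorant_rightEntry_of_leftFixedPoint (g := toB6 g R H) blk d δ₀ α' α α'' θ B Λ Λ' P hB hΛ hP hθ hδ₀ hα'0 hα'1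
    hα1 htri hrefl hsym hdnn h261 hsmall htr₁ htr₂ hY hM hfix

end Extension

end Literature.MathematicalPhysics.QuantumFieldTheory.Balaban1983to89.B9Ineq363L2Right
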